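import Summits.BirchSwinnertonDyer.BirchSwinnertonDyer.Theorems.ResidualThetaTransportAtTwoThetaLayerLambdaCongruenceAtTwoCosocleOfSelfDual
import HarnessLib

/-!
# Crux Kan⁺ `ThetaLayerLambdaCongruenceAtTwo` (stmt-BirchSwinnertonDyer-20688), line `birth`: SOCLE = COSOCLE MOD `2` FROM THE SELF-DUALITY PAIRING ALONE —
# `#J₀(L)[𝔪] = #(Λ/𝔪Λ)` for every ideal `𝔪 ∋ 2`, given a two-sided `𝕋`-balanced pairing on `J₀(L)[2]` (the content of `heckeSelfDual_torsionBy_J0`)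
# (width seat bsd-wall-rtt-p3-w3 g10; `--supports stmt-BirchSwinnertonDyer-20688`; THEOREMS ONLY — no `def`, no `sorry`; BSD is not proved)

The mod-`2` analogue of `Literature.Algebra.Module.SocleCosocle.natCard_torsionBySet_eq_natCard_quotient` (which needs the INTEGRAL pairing on
`Λ = H₁(X₀(L); ℤ)`): here only the reduced pairing on `M = J₀(L)[2]` is used. §4 of the cosocle road:
* `natCard_torsionBySet_eq_natCard_quotient_of_selfDual` — `#J₀(L)[𝔪] = #(Λ/𝔪Λ)` for ANY ideal `𝔪 ∋ 2` (left kernel: `|M/𝔪M| ≤ |M[𝔪]|`,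
  `natCard_quotient_smul_top_le_of_pairing`; right kernel: `|M[𝔪]| ≤ |M/𝔪M|`, `natCard_torsion_le_natCard_quotient_of_pairing`; `Λ/𝔪Λ ≅ M/𝔪M` by
  `x ↦ [x/2]`, steps copied from `exists_fourCosets_periodHomology_of_multiplicityOne`);
* `finrank_torsionBySet_eq_finrank_quotient_of_selfDual` — `dim_{𝕋/𝔪} J₀(L)[𝔪] = dim_{𝕋/𝔪} Λ/𝔪Λ` for maximal `𝔪 ∋ 2`;
* `finrank_torsionBySet_eq_two_of_selfDual_cosocle`, `finrank_torsionBySet_eq_two_of_sd_cosocle` — SUB form from QUOTIENT form + SD (the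
  direction the tree's four socle apply-sites of `buzzard2000_multiplicityOne_gamma0` would need if item 27798 were re-typed on the Picard carrier;
  the converse direction is `finrank_periodHomology_quotient_eq_two_of_selfDual_sub` of `…CosocleOfSelfDual`).
So, GIVEN SD, the SUB and QUOTIENT forms of mod-`2` multiplicity one are interchangeable at every maximal `𝔪 ∋ 2` — whichever coordinate of
`J(Γ)[2]` the ONE Buzzard fact is typed in, the other follows from it and SD; WITHOUT SD only the Picard/quotient form feeds (K2). Nothing here
asserts any named fact; BSD is not proved by any of this.

References: Darmon–Diamond–Taylor (1995) §1.6 Lemma 1.38, §4.5 Thm. 4.26, pp. 133–134 [DarmonDiamondTaylor1995]; Tilouine (1997) Thm. 3.4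
[Tilouine1997Gorenstein]; Buzzard, MRL 7 (2000) Prop. 2.4 [Buzzard2000LevelLoweringModTwo].
-/

-- justification: the `Summit.BirchSwinnertonDyer.BirchSwinnertonDyer.…` path repeats a component (route-file convention)
set_option linter.dupNamespace false
set_option autoImplicit false

noncomputable section

open scoped MatrixGroups ComplexConjugate ModularForm NumberField Pointwise Classical
open CongruenceSubgroup Complex WeierstrassCurve IsDedekindDomain Polynomial Field Matrix Literature.NumberTheory.GaloisRepresentations
open Literature.NumberTheory.EllipticCurves Literature.NumberTheory.EllipticCurves.ModularForms
open Literature.NumberTheory.EllipticCurves.Rank1Residual Rat.HeightOneSpectrum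
open Summit.BirchSwinnertonDyer.BirchSwinnertonDyer.Theses.ResidualThetaTransportAtTwo

namespace Summit.BirchSwinnertonDyer.BirchSwinnertonDyer.Theorems.ThetaLayerLambdaCongruenceAtTwo

/-! ## §4 Socle = cosocle in cardinality and dimension from the two-sided self-duality pairing ALONE (any ideal `𝔪 ∋ 2`) -/

section SocleCosocleModTwo

/-- **`#J₀(L)[𝔪] = #(Λ/𝔪Λ)` from a two-sided `𝕋`-balanced pairing on `J₀(L)[2]`** (the content of `heckeSelfDual_torsionBy_J0` at `ℓ = 2`), for
EVERY ideal `𝔪 ∋ 2` of `𝕋 = HeckeRing0 L 2` — the mod-`2` analogue of `SocleCosocle.natCard_torsionBySet_eq_natCard_quotient` (which needs the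
INTEGRAL pairing). Chain: `J₀(L)[𝔪] = M[𝔪]` (`M = J₀(L)[2]`), `|M/𝔪M| ≤ |M[𝔪]|` (left kernel), `|M[𝔪]| ≤ |M/𝔪M|` (right kernel, §1),
`Λ/𝔪Λ ≅ M/𝔪M` (`x ↦ [x/2]`). USE: converts mod-`2` multiplicity one between SUB form (`dim J₀(L)[𝔪]`) and QUOTIENT form (`dim Λ/𝔪Λ`) in
EITHER direction given SD — whichever coordinate the tree's Buzzard fact is typed in, the other form follows from it AND SD.
[cite: DarmonDiamondTaylor1995, §1.6 Lemma 1.38 and §4.5 Thm. 4.26 (pp. 133–134)] -/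
theorem natCard_torsionBySet_eq_natCard_quotient_of_selfDual {L : ℕ} [NeZero L] (𝔪 : Ideal (HeckeRing0 L 2))
    (h2 : (2 : HeckeRing0 L 2) ∈ 𝔪)
    (B : Submodule.torsionBy (HeckeRing0 L 2) (J0 L) ((2 : ℕ) : HeckeRing0 L 2) →+
      (Submodule.torsionBy (HeckeRing0 L 2) (J0 L) ((2 : ℕ) : HeckeRing0 L 2) →+ ZMod 2))
    (hbal : ∀ (t : HeckeRing0 L 2) x y, B (t • x) y = B x (t • y)) (hleft : ∀ x, (∀ y, B x y = 0) → x = 0)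
    (hright : ∀ y, (∀ x, B x y = 0) → y = 0) :
    Nat.card (Submodule.torsionBySet (HeckeRing0 L 2) (J0 L) 𝔪) =
      Nat.card (periodHomologyHecke L ⧸ (𝔪 • ⊤ : Submodule (HeckeRing0 L 2) (periodHomologyHecke L))) := by
  classical
  haveI hMfin : Finite (Submodule.torsionBy (HeckeRing0 L 2) (J0 L) ((2 : ℕ) : HeckeRing0 L 2)) := J0.finite_torsionBy L (ℓ := 2) two_ne_zero
  have h22 : ((2 : ℕ) : HeckeRing0 L 2) = 2 := Nat.cast_ofNat
  -- (1) `(Submodule.torsionBy (HeckeRing0 L 2) (J0 L) ((2 : ℕ) : HeckeRing0 L 2))` is killed by `2`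
  have h2M : ∀ x : (Submodule.torsionBy (HeckeRing0 L 2) (J0 L) ((2 : ℕ) : HeckeRing0 L 2)), (2 : ℕ) • x = 0 := fun x ↦ by
    have hx := x.2
    rw [Submodule.mem_torsionBy_iff] at hx
    apply Subtype.ext
    rw [AddSubgroupClass.coe_nsmul, ZeroMemClass.coe_zero, ← Nat.cast_smul_eq_nsmul (HeckeRing0 L 2)]
    exact hx
  -- (2) `|(Submodule.torsionBy (HeckeRing0 L 2) (J0 L) ((2 : ℕ) : HeckeRing0 L 2))/𝔪(Submodule.torsionBy (HeckeRing0 L 2) (J0 L) ((2 : ℕ) : HeckeRing0 L 2))| ≤ |(Submodule.torsionBy (HeckeRing0 L 2) (J0 L) ((2 : ℕ) : HeckeRing0 L 2))[𝔪]|`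
  have hleft' : ∀ x : (Submodule.torsionBy (HeckeRing0 L 2) (J0 L) ((2 : ℕ) : HeckeRing0 L 2)), B x = 0 → x = 0 := fun x hx ↦ hleft x fun y ↦ by rw [hx, AddMonoidHom.zero_apply]
  have hle := natCard_quotient_smul_top_le_of_pairing h2M B hbal hleft' 𝔪
  -- (3) `|(Submodule.torsionBy (HeckeRing0 L 2) (J0 L) ((2 : ℕ) : HeckeRing0 L 2))[𝔪]| = |J₀(L)[𝔪]| = |𝕋/𝔪|² = 4`
  have htors_le : Submodule.torsionBySet (HeckeRing0 L 2) (J0 L) 𝔪 ≤ (Submodule.torsionBy (HeckeRing0 L 2) (J0 L) ((2 : ℕ) : HeckeRing0 L 2)) := by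
    rw [h22]
    exact J0.torsionBySet_le_torsionBy L h2
  let e : {x : (Submodule.torsionBy (HeckeRing0 L 2) (J0 L) ((2 : ℕ) : HeckeRing0 L 2)) // ∀ t ∈ 𝔪, t • x = 0} ≃ Submodule.torsionBySet (HeckeRing0 L 2) (J0 L) 𝔪 :=
    { toFun := fun x ↦ ⟨(x.1 : J0 L), (Submodule.mem_torsionBySet_iff _ _).mpr fun t ↦ by
        have h := congrArg Subtype.val (x.2 t t.2)
        exact h⟩
      invFun := fun j ↦ ⟨⟨(j : J0 L), htors_le j.2⟩, fun t ht ↦ Subtype.ext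
        ((Submodule.mem_torsionBySet_iff _ _).mp j.2 ⟨t, ht⟩)⟩
      left_inv := fun x ↦ rfl
      right_inv := fun j ↦ rfl }
  haveI : Finite (Submodule.torsionBySet (HeckeRing0 L 2) (J0 L) 𝔪) := J0.finite_torsionBySet L two_ne_zero (by rw [← h22] at h2; exact h2)
  -- (4) the `𝕋`-linear map `Λ → (Submodule.torsionBy (HeckeRing0 L 2) (J0 L) ((2 : ℕ) : HeckeRing0 L 2))`, `x ↦ [x/2]`
  let D : (periodHomologyHecke L) →ₗ[HeckeRing0 L 2] (Submodule.torsionBy (HeckeRing0 L 2) (J0 L) ((2 : ℕ) : HeckeRing0 L 2)) :=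
    { toFun := fun x ↦ ⟨J0.divMap L 2 ⟨x, (mem_periodHomologyHecke L).mp x.2⟩, by
        rw [Submodule.mem_torsionBy_iff, Nat.cast_smul_eq_nsmul]
        exact J0.nsmul_divMap L 2 _⟩
      map_add' := fun x y ↦ by
        apply Subtype.ext
        change J0.divMap L 2 ⟨(x : Module.Dual ℂ (CuspForm (Gamma0 L) 2)) + (y : Module.Dual ℂ (CuspForm (Gamma0 L) 2)), _⟩ =
          J0.divMap L 2 _ + J0.divMap L 2 _
        rw [← map_add]
        rfl
      map_smul' := fun t x ↦ by
        apply Subtype.ext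
        change Submodule.Quotient.mk ((2 : ℂ)⁻¹ • (t • (x : Module.Dual ℂ (CuspForm (Gamma0 L) 2)))) =
          t • Submodule.Quotient.mk ((2 : ℂ)⁻¹ • (x : Module.Dual ℂ (CuspForm (Gamma0 L) 2)))
        rw [← Submodule.Quotient.mk_smul, heckeRing0_smul_complex_smul] }
  have hDval : ∀ x : (periodHomologyHecke L), ((D x : (Submodule.torsionBy (HeckeRing0 L 2) (J0 L) ((2 : ℕ) : HeckeRing0 L 2))) : J0 L) = Submodule.Quotient.mk ((2 : ℂ)⁻¹ • (x : Module.Dual ℂ _)) := fun x ↦ rfl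
  -- `D` is onto `(Submodule.torsionBy (HeckeRing0 L 2) (J0 L) ((2 : ℕ) : HeckeRing0 L 2))`
  have hDsurj : Function.Surjective D := by
    intro m
    have hm : (m : J0 L) ∈ Submodule.torsionBy (HeckeRing0 L 2) (J0 L) (2 : ℕ) := m.2
    obtain ⟨y, hy⟩ := J0.mem_range_divMap L two_ne_zero hm
    refine ⟨⟨y, (mem_periodHomologyHecke L).mpr y.2⟩, Subtype.ext ?_⟩
    rw [← hy]
    rfl
  -- kernel of `D` lies in `𝔪 • ⊤` (it is `2Λ`)
  have hDker : ∀ z : (periodHomologyHecke L), D z = 0 → z ∈ (𝔪 • ⊤ : Submodule (HeckeRing0 L 2) (periodHomologyHecke L)) := by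
    intro z hz
    have hz' : Submodule.Quotient.mk (p := periodHomologyHecke L) ((2 : ℂ)⁻¹ • (z : Module.Dual ℂ _)) = 0 := by
      rw [← hDval, hz]; rfl
    rw [Submodule.Quotient.mk_eq_zero] at hz'
    -- `z = 2 • w` with `w = z/2 ∈ Λ`
    have hzw : z = (2 : HeckeRing0 L 2) • (⟨(2 : ℂ)⁻¹ • (z : Module.Dual ℂ _), hz'⟩ : (periodHomologyHecke L)) := by
      apply Subtype.ext
      rw [Submodule.coe_smul, show (2 : HeckeRing0 L 2) = ((2 : ℕ) : HeckeRing0 L 2) from h22.symm, Nat.cast_smul_eq_nsmul,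
        ← Nat.cast_smul_eq_nsmul ℂ, smul_smul]
      norm_num
    rw [hzw]
    exact Submodule.smul_mem_smul h2 Submodule.mem_top
  -- (5) the induced map on quotients is injective, so `|Λ/𝔪Λ| ≤ |(Submodule.torsionBy (HeckeRing0 L 2) (J0 L) ((2 : ℕ) : HeckeRing0 L 2))/𝔪(Submodule.torsionBy (HeckeRing0 L 2) (J0 L) ((2 : ℕ) : HeckeRing0 L 2))| ≤ 4`
  have hmaple : Submodule.map D (𝔪 • ⊤ : Submodule (HeckeRing0 L 2) (periodHomologyHecke L)) = (𝔪 • ⊤ : Submodule (HeckeRing0 L 2) (Submodule.torsionBy (HeckeRing0 L 2) (J0 L) ((2 : ℕ) : HeckeRing0 L 2))) := by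
    rw [Submodule.map_smul'', Submodule.map_top, LinearMap.range_eq_top.mpr hDsurj]
  have hinj : ∀ x : (periodHomologyHecke L), D x ∈ (𝔪 • ⊤ : Submodule (HeckeRing0 L 2) (Submodule.torsionBy (HeckeRing0 L 2) (J0 L) ((2 : ℕ) : HeckeRing0 L 2))) → x ∈ (𝔪 • ⊤ : Submodule (HeckeRing0 L 2) (periodHomologyHecke L)) := by
    intro x hx
    rw [← hmaple] at hx
    obtain ⟨y, hy, hyx⟩ := hx
    have hker : D (x - y) = 0 := by rw [map_sub, hyx, sub_self]
    have := hDker _ hker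
    have e : x = y + (x - y) := by abel
    rw [e]
    exact add_mem hy this
  let Dq : ((periodHomologyHecke L) ⧸ (𝔪 • ⊤ : Submodule (HeckeRing0 L 2) (periodHomologyHecke L))) →ₗ[HeckeRing0 L 2] ((Submodule.torsionBy (HeckeRing0 L 2) (J0 L) ((2 : ℕ) : HeckeRing0 L 2)) ⧸ (𝔪 • ⊤ : Submodule (HeckeRing0 L 2) (Submodule.torsionBy (HeckeRing0 L 2) (J0 L) ((2 : ℕ) : HeckeRing0 L 2)))) :=
    Submodule.mapQ _ _ D (fun y hy ↦ by rw [Submodule.mem_comap, ← hmaple]; exact Submodule.mem_map_of_mem hy)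
  have hDq : Function.Injective Dq := by
    rw [← LinearMap.ker_eq_bot, Submodule.eq_bot_iff]
    intro q hq
    obtain ⟨x, rfl⟩ := Submodule.Quotient.mk_surjective _ q
    rw [LinearMap.mem_ker, Submodule.mapQ_apply, Submodule.Quotient.mk_eq_zero] at hq
    exact (Submodule.Quotient.mk_eq_zero _).mpr (hinj x hq)
  haveI : Finite ((Submodule.torsionBy (HeckeRing0 L 2) (J0 L) ((2 : ℕ) : HeckeRing0 L 2)) ⧸ (𝔪 • ⊤ : Submodule (HeckeRing0 L 2) (Submodule.torsionBy (HeckeRing0 L 2) (J0 L) ((2 : ℕ) : HeckeRing0 L 2)))) := Finite.of_surjective _ (Submodule.Quotient.mk_surjective _)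
  haveI hPfin : Finite ((periodHomologyHecke L) ⧸ (𝔪 • ⊤ : Submodule (HeckeRing0 L 2) (periodHomologyHecke L))) := Finite.of_injective Dq hDq
  -- (6) the induced map on quotients is also ONTO, so `|Λ/𝔪Λ| = |M/𝔪M|` (`M = J₀(L)[2]`)
  have hDqsurj : Function.Surjective Dq := by
    intro q
    obtain ⟨m, rfl⟩ := Submodule.Quotient.mk_surjective _ q
    obtain ⟨x, rfl⟩ := hDsurj m
    exact ⟨Submodule.Quotient.mk x, rfl⟩
  have hcardEq : Nat.card ((periodHomologyHecke L) ⧸ (𝔪 • ⊤ : Submodule (HeckeRing0 L 2) (periodHomologyHecke L))) =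
      Nat.card ((Submodule.torsionBy (HeckeRing0 L 2) (J0 L) ((2 : ℕ) : HeckeRing0 L 2)) ⧸ (𝔪 • ⊤ : Submodule (HeckeRing0 L 2) (Submodule.torsionBy (HeckeRing0 L 2) (J0 L) ((2 : ℕ) : HeckeRing0 L 2)))) :=
    Nat.card_congr (Equiv.ofBijective Dq ⟨hDq, hDqsurj⟩)
  -- (7) `|M[𝔪]| ≤ |M/𝔪M|` from the RIGHT kernel, hence `|Λ/𝔪Λ| = 4`
  have hright' : ∀ y : (Submodule.torsionBy (HeckeRing0 L 2) (J0 L) ((2 : ℕ) : HeckeRing0 L 2)), (∀ x, B x y = 0) → y = 0 := hright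
  have hge := natCard_torsion_le_natCard_quotient_of_pairing h2M B hbal hright' 𝔪
  -- (8) count: `|J₀(L)[𝔪]| = |M[𝔪]| = |M/𝔪M| = |Λ/𝔪Λ|`
  rw [← Nat.card_congr e, hcardEq]
  exact le_antisymm hge hle

/-- **Socle = cosocle in dimension from SD alone**: for a maximal `𝔪 ∋ 2`, `dim_{𝕋/𝔪} J₀(L)[𝔪] = dim_{𝕋/𝔪} Λ/𝔪Λ` given a two-sided
`𝕋`-balanced pairing on `J₀(L)[2]`. [cite: DarmonDiamondTaylor1995, §4.5 Thm. 4.26 (pp. 133–134)] -/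
theorem finrank_torsionBySet_eq_finrank_quotient_of_selfDual {L : ℕ} [NeZero L] (𝔪 : Ideal (HeckeRing0 L 2)) [h𝔪 : 𝔪.IsMaximal]
    (h2 : (2 : HeckeRing0 L 2) ∈ 𝔪)
    (B : Submodule.torsionBy (HeckeRing0 L 2) (J0 L) ((2 : ℕ) : HeckeRing0 L 2) →+
      (Submodule.torsionBy (HeckeRing0 L 2) (J0 L) ((2 : ℕ) : HeckeRing0 L 2) →+ ZMod 2))
    (hbal : ∀ (t : HeckeRing0 L 2) x y, B (t • x) y = B x (t • y)) (hleft : ∀ x, (∀ y, B x y = 0) → x = 0)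
    (hright : ∀ y, (∀ x, B x y = 0) → y = 0) :
    Module.finrank (HeckeRing0 L 2 ⧸ 𝔪) (Submodule.torsionBySet (HeckeRing0 L 2) (J0 L) 𝔪) =
      Module.finrank (HeckeRing0 L 2 ⧸ 𝔪)
        (periodHomologyHecke L ⧸ (𝔪 • ⊤ : Submodule (HeckeRing0 L 2) (periodHomologyHecke L))) := by
  classical
  letI : Field (HeckeRing0 L 2 ⧸ 𝔪) := Ideal.Quotient.field 𝔪
  have hcard := natCard_torsionBySet_eq_natCard_quotient_of_selfDual 𝔪 h2 B hbal hleft hright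
  have h2' : ((2 : ℕ) : HeckeRing0 L 2) ∈ 𝔪 := by rw [Nat.cast_ofNat]; exact h2
  haveI : Finite (Submodule.torsionBySet (HeckeRing0 L 2) (J0 L) 𝔪) := J0.finite_torsionBySet L two_ne_zero h2'
  haveI : Finite (HeckeRing0 L 2 ⧸ 𝔪) := HeckeRing0.finite_quotient_of_natCast_mem L two_ne_zero h2'
  haveI : Finite (periodHomologyHecke L ⧸ (𝔪 • ⊤ : Submodule (HeckeRing0 L 2) (periodHomologyHecke L))) := by
    have hpos : 0 < Nat.card (periodHomologyHecke L ⧸ (𝔪 • ⊤ : Submodule (HeckeRing0 L 2) (periodHomologyHecke L))) := by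
      rw [← hcard]; exact Nat.card_pos
    exact (Nat.card_pos_iff.mp hpos).2
  haveI : Module.Finite (HeckeRing0 L 2 ⧸ 𝔪) (Submodule.torsionBySet (HeckeRing0 L 2) (J0 L) 𝔪) := Module.Finite.of_finite
  haveI : Module.Finite (HeckeRing0 L 2 ⧸ 𝔪)
      (periodHomologyHecke L ⧸ (𝔪 • ⊤ : Submodule (HeckeRing0 L 2) (periodHomologyHecke L))) := Module.Finite.of_finite
  have h1 := Module.natCard_eq_pow_finrank (K := HeckeRing0 L 2 ⧸ 𝔪) (V := Submodule.torsionBySet (HeckeRing0 L 2) (J0 L) 𝔪)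
  have h2c := Module.natCard_eq_pow_finrank (K := HeckeRing0 L 2 ⧸ 𝔪)
    (V := periodHomologyHecke L ⧸ (𝔪 • ⊤ : Submodule (HeckeRing0 L 2) (periodHomologyHecke L)))
  have hk : 2 ≤ Nat.card (HeckeRing0 L 2 ⧸ 𝔪) := by
    have := Finite.one_lt_card (α := HeckeRing0 L 2 ⧸ 𝔪)
    omega
  exact Nat.pow_right_injective hk (show Nat.card (HeckeRing0 L 2 ⧸ 𝔪) ^ _ = Nat.card (HeckeRing0 L 2 ⧸ 𝔪) ^ _ by rw [← h1, ← h2c, hcard])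

/-- **SUB form from QUOTIENT form + SD** (the direction a Picard-typed Buzzard fact would need at the tree's four socle apply-sites):
for a maximal `𝔪 ∋ 2`, a two-sided `𝕋`-balanced pairing on `J₀(L)[2]` and `dim_{𝕋/𝔪} Λ/𝔪Λ = 2` give `dim_{𝕋/𝔪} J₀(L)[𝔪] = 2`.
[cite: DarmonDiamondTaylor1995, §4.5 Thm. 4.26 (pp. 133–134)] -/
theorem finrank_torsionBySet_eq_two_of_selfDual_cosocle {L : ℕ} [NeZero L] (𝔪 : Ideal (HeckeRing0 L 2)) [h𝔪 : 𝔪.IsMaximal]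
    (h2 : (2 : HeckeRing0 L 2) ∈ 𝔪)
    (B : Submodule.torsionBy (HeckeRing0 L 2) (J0 L) ((2 : ℕ) : HeckeRing0 L 2) →+
      (Submodule.torsionBy (HeckeRing0 L 2) (J0 L) ((2 : ℕ) : HeckeRing0 L 2) →+ ZMod 2))
    (hbal : ∀ (t : HeckeRing0 L 2) x y, B (t • x) y = B x (t • y)) (hleft : ∀ x, (∀ y, B x y = 0) → x = 0)
    (hright : ∀ y, (∀ x, B x y = 0) → y = 0)
    (hcos : Module.finrank (HeckeRing0 L 2 ⧸ 𝔪)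
      (periodHomologyHecke L ⧸ (𝔪 • ⊤ : Submodule (HeckeRing0 L 2) (periodHomologyHecke L))) = 2) :
    Module.finrank (HeckeRing0 L 2 ⧸ 𝔪) (Submodule.torsionBySet (HeckeRing0 L 2) (J0 L) 𝔪) = 2 := by
  rw [finrank_torsionBySet_eq_finrank_quotient_of_selfDual 𝔪 h2 B hbal hleft hright, hcos]

/-- **SUB form from QUOTIENT form + SD, fact-level**: `heckeSelfDual_torsionBy_J0` turns the conclusion of Buzzard's Prop. 2.4 read on the Picard
carrier (`dim Λ/𝔪Λ = 2`, hypothesis) into the conclusion as typed today (`dim J₀(N)[𝔪] = 2`) at the same `𝔪`. (Migration lemma for a possible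
re-typing of item 27798; nothing here asserts either fact.) [cite: DarmonDiamondTaylor1995, §1.6 Lemma 1.38 and §4.5 (p. 134)] -/
theorem finrank_torsionBySet_eq_two_of_sd_cosocle (hSD : heckeSelfDual_torsionBy_J0) {L : ℕ} [NeZero L] (𝔪 : Ideal (HeckeRing0 L 2))
    [h𝔪 : 𝔪.IsMaximal] (h2 : (2 : HeckeRing0 L 2) ∈ 𝔪)
    (hcos : Module.finrank (HeckeRing0 L 2 ⧸ 𝔪)
      (periodHomologyHecke L ⧸ (𝔪 • ⊤ : Submodule (HeckeRing0 L 2) (periodHomologyHecke L))) = 2) :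
    Module.finrank (HeckeRing0 L 2 ⧸ 𝔪) (Submodule.torsionBySet (HeckeRing0 L 2) (J0 L) 𝔪) = 2 := by
  haveI : Fact (Nat.Prime 2) := ⟨Nat.prime_two⟩
  obtain ⟨B, hbal, hleft, hright⟩ := hSD L 2
  exact finrank_torsionBySet_eq_two_of_selfDual_cosocle 𝔪 h2 B hbal hleft hright hcos

end SocleCosocleModTwo

end Summit.BirchSwinnertonDyer.BirchSwinnertonDyer.Theorems.ThetaLayerLambdaCongruenceAtTwo

end
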